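import Summits.CriticalPhenomena.CardyFormulaZ2.Theses.CardyRotToConf
import Literature.Probability.RandomPlanarGeometry.ChordalCurveFamilyProofs
import Literature.Probability.RandomPlanarGeometry.PlanarDomainsTopology
import Literature.Topology.PlaneTopology.JordanCurveProofs
import Literature.Topology.PlaneTopology.CrosscutProofs
import HarnessLib

/-!
# Local arc structure of the boundary of a Jordan domain; rays and stubs
# (one-shot surgery for crux `CardyRotToConfR2SymmetryUpgrade`, stmt-CriticalPhenomena-0698)

Compactness (`exists_radius_param_near`), rotations, the two-sidedness/IVT lemma
`exists_param_nhds_subset_sphere`, `exists_radius_frontier_subset_sphere`; `rayFrom`, `unitDir`.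
Negative lane: no Theses statement is asserted; overview in `Negative/OneShotSurgery.lean`.
-/

noncomputable section

open MeasureTheory Set Metric Filter Topology
open scoped unitInterval ENNReal Real
open Literature.Probability.RandomPlanarGeometry Literature.Probability.RandomPlanarGeometry.ChordalFamily
open Literature.Topology.PlaneTopology

namespace Summit.CriticalPhenomena.CardyFormulaZ2.Theorems.CardyRotToConfR2SymmetryUpgrade.Negative

/-! ### Local arc structure of the boundary of a Jordan domain -/

namespace JordanLocal

variable (J : JordanDomain) (t₀ : ℝ)

/-- **Compactness**: frontier points near `boundary t₀` have parameters near `t₀` (mod the period).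
[folklore] -/
theorem exists_radius_param_near {δ : ℝ} (hδ : 0 < δ) (hδ1 : δ ≤ 1 / 2) :
    ∃ r₂ > 0, ∀ z ∈ frontier J.carrier, dist z (J.boundary t₀) < r₂ →
      ∃ s ∈ Ioo (t₀ - δ) (t₀ + δ), J.boundary s = z := by
  -- the far part of the curve
  set K : Set ℂ := J.boundary '' Icc (t₀ + δ) (t₀ + 1 - δ) with hK
  have hKc : IsCompact K := isCompact_Icc.image J.continuous_boundary
  have hxK : J.boundary t₀ ∉ K := by
    rintro ⟨s, hs, heq⟩
    have h := J.injOn_boundary_Ico t₀ ⟨by linarith [hs.1], by linarith [hs.2]⟩ ⟨le_rfl, by linarith⟩ heq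
    linarith [hs.1]
  -- positive distance from `x` to `K`
  obtain ⟨r₂, hr₂, hfar⟩ : ∃ r₂ > 0, ∀ w ∈ K, r₂ ≤ dist w (J.boundary t₀) := by
    rcases K.eq_empty_or_nonempty with hKe | hKne
    · exact ⟨1, one_pos, fun w hw => by rw [hKe] at hw; exact hw.elim⟩
    · obtain ⟨w₀, hw₀, hmin⟩ := hKc.exists_isMinOn hKne (continuous_id.dist continuous_const).continuousOn
      exact ⟨dist w₀ (J.boundary t₀), dist_pos.2 (fun h => hxK (h ▸ hw₀)), fun w hw => hmin hw⟩
  refine ⟨r₂, hr₂, fun z hz hdist => ?_⟩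
  rw [← J.range_boundary] at hz
  obtain ⟨s', rfl⟩ := hz
  obtain ⟨s, hs, hss'⟩ := J.periodic_boundary.exists_mem_Ico one_pos s' (t₀ - δ)
  rw [hss'] at hdist ⊢
  refine ⟨s, ⟨lt_of_le_of_ne hs.1 ?_, ?_⟩, rfl⟩
  · intro h
    -- `s = t₀ - δ` maps to the same point as `t₀ + 1 - δ ∈ K`
    have hmem : J.boundary s ∈ K := by
      refine ⟨t₀ + 1 - δ, ⟨by linarith, le_rfl⟩, ?_⟩
      rw [show t₀ + 1 - δ = s + 1 by rw [← h]; ring, J.periodic_boundary]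
    exact absurd (hfar _ hmem) (not_le.2 hdist)
  · by_contra hge
    rw [not_lt] at hge
    have hmem : J.boundary s ∈ K := ⟨s, ⟨hge, by linarith [hs.2]⟩, rfl⟩
    exact absurd (hfar _ hmem) (not_le.2 hdist)

/-- The rotation of `x` about `m` by the angle `θ`. -/
def rot (m x : ℂ) (θ : ℝ) : ℂ := m + (x - m) * Complex.exp (θ * Complex.I)

/-- `rot m x 0 = x`. -/
theorem rot_zero (m x : ℂ) : rot m x 0 = x := by simp [rot]

/-- `rot` is continuous in the angle. -/
theorem continuous_rot (m x : ℂ) : Continuous (rot m x) := by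
  unfold rot; fun_prop

/-- Rotations stay on the circle. -/
theorem dist_rot_center (m x : ℂ) (θ : ℝ) : dist (rot m x θ) m = dist x m := by
  rw [rot, dist_eq_norm, dist_eq_norm, add_sub_cancel_left, norm_mul, Complex.norm_exp_ofReal_mul_I, mul_one]

/-- Rotations by angles in `[-1, 1]` are injective. -/
theorem rot_injOn {m x : ℂ} (hxm : x ≠ m) : InjOn (rot m x) (Icc (-1) 1) := by
  intro θ₁ h₁ θ₂ h₂ heq
  rw [rot, rot, add_right_inj] at heq
  have hexp : Complex.exp (θ₁ * Complex.I) = Complex.exp (θ₂ * Complex.I) :=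
    mul_left_cancel₀ (sub_ne_zero.2 hxm) heq
  obtain ⟨n, hn⟩ := Complex.exp_eq_exp_iff_exists_int.1 hexp
  have h' : θ₁ = θ₂ + n * (2 * π) := by
    have := congrArg Complex.im hn
    simpa using this
  by_contra hne
  have hn0 : n ≠ 0 := by
    rintro rfl
    apply hne
    rw [h']; simp
  have h1 : (1 : ℝ) ≤ |(n : ℝ)| := by exact_mod_cast Int.one_le_abs hn0
  have h2 : |θ₁ - θ₂| ≤ 2 := by
    rw [abs_le]; constructor <;> linarith [h₁.1, h₁.2, h₂.1, h₂.2]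
  have h3 : |θ₁ - θ₂| = |(n : ℝ)| * (2 * π) := by
    rw [h', add_sub_cancel_left, abs_mul, abs_of_pos (by positivity : (0 : ℝ) < 2 * π)]
  have h4 : 2 * π ≤ |(n : ℝ)| * (2 * π) := by nlinarith [Real.pi_pos]
  linarith [Real.pi_gt_three]

variable {J t₀}

/-- **Two-sidedness ⇒ local arc.** If a circle through `x = boundary t₀` contains every frontier
point... precisely: if all small rotations of `x` about `m` lie on the frontier, then a whole
parameter neighbourhood of `t₀` is mapped INTO the circle. [folklore] -/
theorem exists_param_nhds_subset_sphere {m : ℂ} (hxm : J.boundary t₀ ≠ m) {r : ℝ} (hr : 0 < r)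
    (hA : ∀ w, dist w m = dist (J.boundary t₀) m → dist w (J.boundary t₀) < r → w ∈ frontier J.carrier) :
    ∃ η > 0, ∀ s ∈ Ioo (t₀ - η) (t₀ + η), dist (J.boundary s) m = dist (J.boundary t₀) m := by
  set x := J.boundary t₀ with hx
  set δ : ℝ := 1 / 4 with hδ
  obtain ⟨r₂, hr₂, hpar⟩ := exists_radius_param_near J t₀ (by norm_num : (0 : ℝ) < 1 / 4) (by norm_num)
  -- small angles keep the rotated point within `min r r₂` of `x`
  have hcont : Continuous fun θ : ℝ => dist (rot m x θ) x := (continuous_rot m x).dist continuous_const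
  obtain ⟨α, hα0, hα⟩ : ∃ α > 0, α ≤ 1 ∧ ∀ θ : ℝ, |θ| ≤ α → dist (rot m x θ) x < min r r₂ := by
    have h0 : dist (rot m x 0) x < min r r₂ := by rw [rot_zero, dist_self]; exact lt_min hr hr₂
    have := (Metric.continuousAt_iff.1 (hcont.continuousAt (x := (0 : ℝ)))) (min r r₂ - dist (rot m x 0) x)
      (by linarith)
    obtain ⟨β, hβ, hβ'⟩ := this
    refine ⟨min (β / 2) 1, by positivity, min_le_right _ _, fun θ hθ => ?_⟩
    have hθβ : dist θ 0 < β := by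
      rw [dist_zero_right, Real.norm_eq_abs]
      exact lt_of_le_of_lt hθ (lt_of_le_of_lt (min_le_left _ _) (by linarith))
    have := hβ' hθβ
    rw [Real.dist_eq, abs_lt] at this
    linarith [this.2]
  obtain ⟨hα1, hαr⟩ := hα
  -- each small rotation is a frontier point with a unique parameter in `(t₀ - δ, t₀ + δ)`
  have hex : ∀ θ : ℝ, |θ| ≤ α → ∃ s ∈ Ioo (t₀ - δ) (t₀ + δ), J.boundary s = rot m x θ := by
    intro θ hθ
    have hd := hαr θ hθ
    refine hpar _ (hA _ (dist_rot_center m x θ) (lt_of_lt_of_le hd (min_le_left _ _)))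
      (lt_of_lt_of_le hd (min_le_right _ _))
  -- the parameter map on the compact angle interval, valued in the compact parameter interval
  set Θ := Icc (-α) α with hΘ
  set P := Icc (t₀ - δ) (t₀ + δ) with hP
  have hinjP : InjOn J.boundary P := J.injOn_boundary_Icc (by rw [hδ]; linarith)
  let Φ : P → ℂ := fun s => J.boundary s
  have hΦc : Continuous Φ := J.continuous_boundary.comp continuous_subtype_val
  have hΦi : Function.Injective Φ := fun s₁ s₂ h => Subtype.ext (hinjP s₁.2 s₂.2 h)
  have hΦemb : IsClosedEmbedding Φ := hΦc.isClosedEmbedding hΦi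
  have hmemΘ : ∀ θ : Θ, |(θ : ℝ)| ≤ α := fun θ => abs_le.2 ⟨by linarith [θ.2.1], θ.2.2⟩
  let g : Θ → P := fun θ => ⟨(hex θ (hmemΘ θ)).choose, Ioo_subset_Icc_self (hex θ (hmemΘ θ)).choose_spec.1⟩
  have hgΦ : ∀ θ : Θ, Φ (g θ) = rot m x θ := fun θ => (hex θ (hmemΘ θ)).choose_spec.2
  have hgc : Continuous g := by
    rw [hΦemb.isInducing.continuous_iff]
    have : Φ ∘ g = fun θ : Θ => rot m x θ := funext hgΦ
    rw [this]
    exact (continuous_rot m x).comp continuous_subtype_val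
  have hginj : Function.Injective g := by
    intro θ₁ θ₂ h
    have h' : rot m x θ₁ = rot m x θ₂ := by rw [← hgΦ, ← hgΦ, h]
    exact Subtype.ext (rot_injOn hxm (Icc_subset_Icc (by linarith) hα1 θ₁.2) (Icc_subset_Icc (by linarith) hα1 θ₂.2) h')
  -- extend to a continuous real function
  let G : ℝ → ℝ := fun θ => (g (projIcc (-α) α (by linarith) θ) : ℝ)
  have hGc : Continuous G := continuous_subtype_val.comp (hgc.comp continuous_projIcc)
  have hGg : ∀ θ (hθ : θ ∈ Θ), G θ = g ⟨θ, hθ⟩ := fun θ hθ => by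
    simp only [G, projIcc_of_mem _ hθ]
  have hGb : ∀ θ, θ ∈ Θ → J.boundary (G θ) = rot m x θ := fun θ hθ => by rw [hGg θ hθ]; exact hgΦ ⟨θ, hθ⟩
  have hG0 : G 0 = t₀ := by
    have h0Θ : (0 : ℝ) ∈ Θ := ⟨by linarith, hα0.le⟩
    have hb := hGb 0 h0Θ
    rw [rot_zero] at hb
    have hmemP : G 0 ∈ P := by rw [hGg 0 h0Θ]; exact (g ⟨0, h0Θ⟩).2
    exact hinjP hmemP ⟨by rw [hδ]; linarith, by rw [hδ]; linarith⟩ hb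
  have hGinj : InjOn G Θ := by
    intro θ₁ h₁ θ₂ h₂ h
    rw [hGg θ₁ h₁, hGg θ₂ h₂] at h
    exact congrArg Subtype.val (hginj (Subtype.ext h)) |> fun e => by simpa using e
  have hαΘ : α ∈ Θ := ⟨by linarith, le_rfl⟩
  have hαΘ' : -α ∈ Θ := ⟨le_rfl, by linarith⟩
  have h0Θ : (0 : ℝ) ∈ Θ := ⟨by linarith, hα0.le⟩
  have hne₁ : G α ≠ t₀ := fun h => by
    have := hGinj hαΘ h0Θ (h.trans hG0.symm); linarith
  have hne₂ : G (-α) ≠ t₀ := fun h => by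
    have := hGinj hαΘ' h0Θ (h.trans hG0.symm); linarith
  have hne₃ : G (-α) ≠ G α := fun h => by
    have := hGinj hαΘ' hαΘ h; linarith
  -- `t₀` lies strictly between `G (-α)` and `G α`
  have key : (G (-α) < t₀ ∧ t₀ < G α) ∨ (G α < t₀ ∧ t₀ < G (-α)) := by
    -- an intermediate value argument excludes both values on the same side
    have ivt_left : ∀ v, v ∈ Icc (min (G (-α)) t₀) (max (G (-α)) t₀) → ∃ θ ∈ Icc (-α) 0, G θ = v := by
      intro v hv
      rcases le_total (G (-α)) t₀ with hle | hle
      · rw [min_eq_left hle, max_eq_right hle] at hv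
        obtain ⟨θ, hθ, hθv⟩ := intermediate_value_Icc (by linarith : -α ≤ (0 : ℝ)) hGc.continuousOn
          (show v ∈ Icc (G (-α)) (G 0) by rw [hG0]; exact hv)
        exact ⟨θ, hθ, hθv⟩
      · rw [min_eq_right hle, max_eq_left hle] at hv
        obtain ⟨θ, hθ, hθv⟩ := intermediate_value_Icc' (by linarith : -α ≤ (0 : ℝ)) hGc.continuousOn
          (show v ∈ Icc (G 0) (G (-α)) by rw [hG0]; exact hv)
        exact ⟨θ, hθ, hθv⟩
    have ivt_right : ∀ v, v ∈ Icc (min t₀ (G α)) (max t₀ (G α)) → ∃ θ ∈ Icc 0 α, G θ = v := by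
      intro v hv
      rcases le_total t₀ (G α) with hle | hle
      · rw [min_eq_left hle, max_eq_right hle] at hv
        obtain ⟨θ, hθ, hθv⟩ := intermediate_value_Icc hα0.le hGc.continuousOn
          (show v ∈ Icc (G 0) (G α) by rw [hG0]; exact hv)
        exact ⟨θ, hθ, hθv⟩
      · rw [min_eq_right hle, max_eq_left hle] at hv
        obtain ⟨θ, hθ, hθv⟩ := intermediate_value_Icc' hα0.le hGc.continuousOn
          (show v ∈ Icc (G α) (G 0) by rw [hG0]; exact hv)
        exact ⟨θ, hθ, hθv⟩
    rcases lt_or_gt_of_ne hne₁ with h1 | h1 <;> rcases lt_or_gt_of_ne hne₂ with h2 | h2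
    · -- both below `t₀`: the larger one is hit on the other side
      exfalso
      rcases lt_or_gt_of_ne hne₃ with h3 | h3
      · -- G(-α) < G α < t₀: `G α` is a value of `G` on `[-α, 0]`
        obtain ⟨θ, hθ, hθv⟩ := ivt_left (G α) ⟨by rw [min_eq_left h2.le]; exact h3.le, by rw [max_eq_right h2.le]; exact h1.le⟩
        have := hGinj (Icc_subset_Icc le_rfl hα0.le hθ) hαΘ hθv
        rw [this] at hθ; linarith [hθ.2]
      · obtain ⟨θ, hθ, hθv⟩ := ivt_right (G (-α)) ⟨by rw [min_eq_right h1.le]; exact h3.le, by rw [max_eq_left h1.le]; exact h2.le⟩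
        have := hGinj (Icc_subset_Icc (by linarith) le_rfl hθ) hαΘ' hθv
        rw [this] at hθ; linarith [hθ.1]
    · exact Or.inr ⟨h1, h2⟩
    · exact Or.inl ⟨h2, h1⟩
    · exfalso
      rcases lt_or_gt_of_ne hne₃ with h3 | h3
      · obtain ⟨θ, hθ, hθv⟩ := ivt_right (G (-α)) ⟨by rw [min_eq_left h1.le]; exact h2.le, by rw [max_eq_right h1.le]; exact h3.le⟩
        have := hGinj (Icc_subset_Icc (by linarith) le_rfl hθ) hαΘ' hθv
        rw [this] at hθ; linarith [hθ.1]
      · obtain ⟨θ, hθ, hθv⟩ := ivt_left (G α) ⟨by rw [min_eq_right h2.le]; exact h1.le, by rw [max_eq_left h2.le]; exact h3.le⟩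
        have := hGinj (Icc_subset_Icc le_rfl hα0.le hθ) hαΘ hθv
        rw [this] at hθ; linarith [hθ.2]
  -- conclude with `η` = the distance to the nearer endpoint value
  have himage : ∀ s, s ∈ Icc (min (G (-α)) (G α)) (max (G (-α)) (G α)) → ∃ θ ∈ Θ, G θ = s := by
    intro s hs
    rcases le_total (G (-α)) (G α) with hle | hle
    · rw [min_eq_left hle, max_eq_right hle] at hs
      obtain ⟨θ, hθ, hθs⟩ := intermediate_value_Icc (by linarith : -α ≤ α) hGc.continuousOn hs
      exact ⟨θ, hθ, hθs⟩
    · rw [min_eq_right hle, max_eq_left hle] at hs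
      obtain ⟨θ, hθ, hθs⟩ := intermediate_value_Icc' (by linarith : -α ≤ α) hGc.continuousOn hs
      exact ⟨θ, hθ, hθs⟩
  refine ⟨min (|G (-α) - t₀|) (|G α - t₀|), lt_min (abs_pos.2 (sub_ne_zero.2 hne₂)) (abs_pos.2 (sub_ne_zero.2 hne₁)), fun s hs => ?_⟩
  have hs' : s ∈ Icc (min (G (-α)) (G α)) (max (G (-α)) (G α)) := by
    rcases key with ⟨h1, h2⟩ | ⟨h1, h2⟩
    · rw [abs_of_neg (by linarith : G (-α) - t₀ < 0), abs_of_pos (by linarith : 0 < G α - t₀)] at hs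
      rw [min_eq_left (by linarith : G (-α) ≤ G α), max_eq_right (by linarith : G (-α) ≤ G α)]
      constructor <;> nlinarith [hs.1, hs.2, min_le_left (-(G (-α) - t₀)) (G α - t₀), min_le_right (-(G (-α) - t₀)) (G α - t₀)]
    · rw [abs_of_pos (by linarith : 0 < G (-α) - t₀), abs_of_neg (by linarith : G α - t₀ < 0)] at hs
      rw [min_eq_right (by linarith : G α ≤ G (-α)), max_eq_left (by linarith : G α ≤ G (-α))]
      constructor <;> nlinarith [hs.1, hs.2, min_le_left (G (-α) - t₀) (-(G α - t₀)), min_le_right (G (-α) - t₀) (-(G α - t₀))]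
  obtain ⟨θ, hθ, hθs⟩ := himage s hs'
  rw [← hθs, hGb θ hθ, dist_rot_center]

/-- **The frontier is locally on the circle.** Under the hypothesis of
`exists_param_nhds_subset_sphere`, frontier points near `x` lie on the circle. [folklore] -/
theorem exists_radius_frontier_subset_sphere {m : ℂ} (hxm : J.boundary t₀ ≠ m) {r : ℝ} (hr : 0 < r)
    (hA : ∀ w, dist w m = dist (J.boundary t₀) m → dist w (J.boundary t₀) < r → w ∈ frontier J.carrier) :
    ∃ η > 0, (∀ s ∈ Ioo (t₀ - η) (t₀ + η), dist (J.boundary s) m = dist (J.boundary t₀) m) ∧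
      ∀ η' ∈ Ioc 0 η, ∃ r₃ > 0, ∀ z ∈ frontier J.carrier, dist z (J.boundary t₀) < r₃ →
        ∃ s ∈ Ioo (t₀ - η') (t₀ + η'), J.boundary s = z := by
  obtain ⟨η, hη, hsph⟩ := exists_param_nhds_subset_sphere hxm hr hA
  refine ⟨min η (1 / 2), lt_min hη (by norm_num), fun s hs => hsph s ⟨?_, ?_⟩, fun η' hη' => ?_⟩
  · linarith [hs.1, min_le_left η (1 / 2)]
  · linarith [hs.2, min_le_left η (1 / 2)]
  · exact exists_radius_param_near J t₀ hη'.1 (hη'.2.trans (min_le_right _ _))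

end JordanLocal

/-! ### Rays and stubs -/

section Stubs

/-- A preconnected set meeting an open set and avoiding its frontier lies inside it. [folklore] -/
theorem subset_of_isPreconnected_of_disjoint_frontier {S O : Set ℂ} (hS : IsPreconnected S) (hO : IsOpen O)
    (hne : (S ∩ O).Nonempty) (hfr : ∀ z ∈ S, z ∉ frontier O) : S ⊆ O := by
  refine hS.subset_of_closure_inter_subset hO hne ?_
  rintro z ⟨hzcl, hzS⟩
  by_contra hzO
  exact hfr z hzS (by rw [hO.frontier_eq]; exact ⟨hzcl, hzO⟩)

/-- The unit direction from `m` to `y`. -/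
def unitDir (m y : ℂ) : ℂ := (y - m) / ((dist y m : ℝ) : ℂ)

/-- `‖unitDir m y‖ = 1` for `y ≠ m`. -/
theorem norm_unitDir {m y : ℂ} (h : y ≠ m) : ‖unitDir m y‖ = 1 := by
  rw [unitDir, norm_div, Complex.norm_real, Real.norm_eq_abs, abs_of_pos (dist_pos.2 h), dist_eq_norm,
    div_self (norm_ne_zero_iff.2 (sub_ne_zero.2 h))]

/-- The point at distance `t` from `m` in the direction `u`. -/
def rayFrom (m u : ℂ) (t : ℝ) : ℂ := m + (t : ℂ) * u

/-- `rayFrom` is continuous in `t`. -/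
theorem continuous_rayFrom (m u : ℂ) : Continuous (rayFrom m u) := by unfold rayFrom; fun_prop

/-- Distance of a ray point to the centre. -/
theorem dist_rayFrom_center {m u : ℂ} (hu : ‖u‖ = 1) (t : ℝ) : dist (rayFrom m u t) m = |t| := by
  rw [rayFrom, dist_eq_norm, add_sub_cancel_left, norm_mul, Complex.norm_real, hu, mul_one, Real.norm_eq_abs]

/-- Distance between two ray points. -/
theorem dist_rayFrom_rayFrom {m u : ℂ} (hu : ‖u‖ = 1) (t t' : ℝ) :
    dist (rayFrom m u t) (rayFrom m u t') = |t - t'| := by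
  rw [rayFrom, rayFrom, dist_eq_norm, show m + (t : ℂ) * u - (m + (t' : ℂ) * u) = ((t - t' : ℝ) : ℂ) * u by
    push_cast; ring, norm_mul, Complex.norm_real, hu, mul_one, Real.norm_eq_abs]

/-- The ray through `y` reaches `y` at distance `dist y m`. -/
theorem rayFrom_dist {m y : ℂ} (h : y ≠ m) : rayFrom m (unitDir m y) (dist y m) = y := by
  rw [rayFrom, unitDir, mul_div_cancel₀ _ (by exact_mod_cast (dist_pos.2 h).ne')]
  ring

end Stubs

end Summit.CriticalPhenomena.CardyFormulaZ2.Theorems.CardyRotToConfR2SymmetryUpgrade.Negative
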